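import Literature.NumberTheory.EllipticCurves.OverconvergentModularSymbolsWeightTwo
import Literature.NumberTheory.EllipticCurves.ModularSymbolsRationalWeightTwo
import Literature.NumberTheory.EllipticCurves.ModularFormsGamma0Genus
import HarnessLib

/-!
# Weight-two overconvergent modular symbols: the classical symbols `MSymb` are the tree's
# `Symb_{Γ₀(M)}(Sym⁰ ℚ_p)`, Hecke-equivariantly, and `φ_f`, `φ_β` are modular symbols of levels
# `Γ₀(N)`, `Γ₀(Np)`

Companion to `OverconvergentModularSymbolsWeightTwo` (definition item
`defn-OverconvergentModularSymbolsWeightTwo` = D5′ of the BSD cell `bsd-schneider-ideate`, planner memo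
`ROUTE-P3-D5prime-wt2OMS-g17.md`; typer unit `bsd-lit-ps-wt2`, gen 1).  That file encodes a weight-`0` modular
symbol as a VALUE FUNCTION `φ : ℚ → V`, `φ(r) = Φ({∞} − {r})`, with the `Γ₀(M)`-relations written through
`moebius`/`extInfty` (`MSymb`, `OMSymb`), and introduces the classical plus symbol `φ_f = phiClassical f` and
its `p`-stabilisation `φ_β = phiBeta f β` as bare functions.  The tree ALREADY carries (since 2026-08-17) the
abstract modular symbols of Bellaïche / Pollack–Stevens in the two-cusp encoding
`Symb_Γ(V) = Hom_Γ(Δ₀, V) ⊆ (ℙ¹(ℚ) → ℙ¹(ℚ) → V)` (`ModularSymbolsCoefficients`: `P1Q`, `modSym`,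
`CoeffActionOn.slash/Symb/hecke`), with the classical weight-two symbol of a rational newform and its
`p`-stabilisation PROVED to be members (`ModularSymbolsRationalWeightTwo`: `padSymb_mem_Symb`,
`padStabSymb_spec`).  This file is the bridge, so that the two vocabularies are one:

* `P1Q.act_infty_eq`, `P1Q.act_ofRat_eq_ite`: the Möbius action on cusps in closed form, i.e. the
  dictionary `moebius ↔ P1Q.act` (`toP1Q_moebius`), and `slash₀` as a difference of a potential
  (`slash₀_apply`);
* `valFun ψ = (r ↦ ψ(∞, r))` and `MSymb.ofSymb` / `MSymb.toSymb` / **`MSymb.equivSymb :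
  MSymb p M ≃ Symb_{Γ₀(M)}(Sym⁰ ℚ_p)`** [PollackStevens2011, §2.1: `Δ₀` has the `ℤ`-basis `{r} − {∞}`];
* Hecke equivariance of the dictionary: `Up₀_valFun` (`U_p` at level `Np`), `Tl₀_valFun` (`T_ℓ`, `ℓ ∤ M`),
  `invol₀_valFun` (`ι`), hence `Up₀_ofSymb_of_hecke_eq_smul` (eigen-equations transport);
* bounded values: `MSymb.exists_norm_le` (Manin: finitely many unimodular values; the tree's
  `exists_norm_apply_le`);
* **`phiClassicalMSymb f : MSymb p N`** and **`phiBetaMSymb f β : MSymb p (N·p)`** with value functions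
  `phiClassical f`, `phiBeta f β` (`phiClassicalMSymb_toFun`, `phiBetaMSymb_toFun`), for a normalised newform
  with rational coefficients (`IsNewform0 f`, `coeffField f = ⊥`; the period `Ω⁺_f > 0` is the tree theorem
  `IsNewform0.plusPeriod_pos_holds`), `p ∤ N`, and ANY non-zero root `β` of `X² − a_p X + p` — in
  particular the critical-slope root of the A2 corner; elliptic-curve forms `…Of` under `IsNewformOf W f`.
  This is the membership clause of the item's O5 («`φ_W ∈ MSymb N`, `φ_β ∈ MSymb(Np)`») and the
  consistency check that the named facts `pollackStevens_criticalSlope_eigenLift` /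
  `pollackStevens2013_eigenLiftFull_of_not_isLocallySplitAt` (whose conclusion `ρ₀^*(Φ_β) = φ_β` with
  `Φ_β ∈ Symb_{Γ₀(Np)}(𝐃)` forces `φ_β ∈ Symb_{Γ₀(Np)}(ℚ_p)`) are not vacuously false in the tree's encoding.

Everything is proved; NO named facts; no instance, no notation.

## Relation to the tree's slope-`0` theory (recorded for the debt queue; nothing here depends on it)

`ModularSymbolsDistributionCoefficients` (`distCoeff` = weight-`k` MEASURES `𝔻_k(ℤ_p)` on `Σ₀(N)`, `specHom =
ρ_k^*`), `ModularSymbolsGreenbergLifting`, `ModularSymbolsControlInjective/Surjective/Unique` and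
`ModularSymbolsOrdinaryMeasuresApprox.existsUnique_measureValued_eigensymbol_of_exact` PROVE Stevens' control
theorem in slope `0` (Greenberg 2007, Thm. 9) for measure coefficients.  At `k = 0` "slope `< k + 1`" IS slope
`0`, so the named fact `stevensControl_slope_lt_one` of `OverconvergentModularSymbolsWeightTwo` is, in
substance, that theorem read in Pollack–Stevens' larger coefficient module `𝐃 ⊋ Meas(ℤ_p)` (bounded moment
sequences, [PollackStevens2011, Prop. 3.1]); its discharge needs, beyond this file, a coefficient system on
`𝐃` (associativity of `Dist.act` on `S₀(p)`), the measure-to-moments map commuting with the actions, and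
uniqueness in `𝐃` ([PollackStevens2011, proof of Thm. 5.12]: `Φ = α⁻ⁿ Φ|U_pⁿ` with `act_heckeMat` and uniform
boundedness).  The critical-slope symbol `Φ_β` of the item is NOT measure-valued (`1`-admissible), so `Dist`
is not a duplicate of `distCoeff`.

## References

* R. Pollack, G. Stevens, *Overconvergent modular symbols and `p`-adic `L`-functions*, Ann. Sci. ÉNS 44
  (2011), §2.1 (symbols, Hecke operators, the involution), §6.3/§8 (`φ_f^±`, `φ_β`). [PollackStevens2011]
* B. Mazur, J. Tate, J. Teitelbaum, Invent. Math. 84 (1986), §I.8 (bounded denominators), §I.10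
  (`p`-stabilisation). [MazurTateTeitelbaum1986Invent]
* Ju. I. Manin, Izv. Akad. Nauk SSSR 36 (1972), §1.4–1.6. [Manin1972]
-/

noncomputable section

open scoped MatrixGroups ModularForm
open CongruenceSubgroup Matrix

namespace Literature.NumberTheory.EllipticCurves

open ModularForms

/-! ## §1 The Möbius action on cusps in closed form -/

namespace P1Q

/-- **`g·∞` in closed form**: `∞` if `c = 0`, else `a/c` (`g = (a b; c d)`, `det g ≠ 0`).
[cite: PollackStevens2011, §2.1 (p. 7): "GL₂(ℚ) acts on Δ₀ via linear fractional transformations"] -/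
theorem act_infty_eq {g : Matrix (Fin 2) (Fin 2) ℤ} (hg : g.det ≠ 0) :
    act g infty = if g 1 0 = 0 then infty else ofRat ((g 0 0 : ℚ) / (g 1 0 : ℚ)) := by
  obtain ⟨h, he⟩ := act_infty hg
  rw [he]
  split_ifs with hc
  · exact mk_eq_infty h (by simp [hc])
  · rw [mk_eq_ofRat h (by simpa using hc)]
    simp

/-- **`g·r` in closed form**: `∞` if `cr + d = 0`, else `(ar + b)/(cr + d)` (`det g ≠ 0`).
[cite: PollackStevens2011, §2.1 (p. 7): "GL₂(ℚ) acts on Δ₀ via linear fractional transformations"] -/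
theorem act_ofRat_eq_ite {g : Matrix (Fin 2) (Fin 2) ℤ} (hg : g.det ≠ 0) (r : ℚ) :
    act g (ofRat r) = if (g 1 0 : ℚ) * r + g 1 1 = 0 then infty
      else ofRat (((g 0 0 : ℚ) * r + (g 0 1 : ℚ)) / ((g 1 0 : ℚ) * r + (g 1 1 : ℚ))) := by
  split_ifs with hden
  · rw [ofRat, act_mk hg]
    have h1 : (ratMat g *ᵥ ![r, 1]) 1 = 0 := by
      simp [Matrix.mulVec, dotProduct, Fin.sum_univ_two]
      exact hden
    exact mk_eq_infty _ h1
  · exact act_ofRat_eq hg r hden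

end P1Q

namespace OMSWeightTwo

variable {p : ℕ} [Fact p.Prime]

/-! ## §2 The dictionary `Option ℚ ↔ ℙ¹(ℚ)`, potentials, and `slash₀` as a difference of a potential -/

/-- The cusp of `x ∈ ℚ ∪ {∞}` (`none = ∞`), in the tree's `P1Q = ℙ(ℚ²)`. [folklore] -/
def toP1Q : Option ℚ → P1Q
  | some r => P1Q.ofRat r
  | none => P1Q.infty

/-- `toP1Q (some r) = r`. [folklore] -/
@[simp] private theorem toP1Q_some (r : ℚ) : toP1Q (some r) = P1Q.ofRat r := rfl

/-- `toP1Q none = ∞`. [folklore] -/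
@[simp] private theorem toP1Q_none : toP1Q none = P1Q.infty := rfl

/-- **`moebius` is the projective action**: `toP1Q (γ·x) = γ·(toP1Q x)` for `det γ ≠ 0`.
[cite: PollackStevens2011, §2.1 (p. 7): "GL₂(ℚ) acts via linear fractional transformations"] -/
theorem toP1Q_moebius (γ : Matrix (Fin 2) (Fin 2) ℤ) (hγ : γ.det ≠ 0) (x : Option ℚ) :
    toP1Q (moebius γ x) = P1Q.act γ (toP1Q x) := by
  cases x with
  | none =>
    rw [toP1Q_none, P1Q.act_infty_eq hγ, moebius]
    split_ifs <;> rfl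
  | some r =>
    rw [toP1Q_some, P1Q.act_ofRat_eq_ite hγ, moebius]
    split_ifs <;> rfl

open Classical in
/-- **The potential of a value function** on `ℙ¹(ℚ)`: `pot Φ (r) = Φ r` (`= Φ({∞} − {r})`),
`pot Φ (∞) = 0` (`= Φ({∞} − {∞})`). [cite: PollackStevens2011, §2.1 (p. 7)] -/
def pot {V : Type*} [Zero V] (Φ : ℚ → V) (x : P1Q) : V :=
  if hx : ∃ r : ℚ, x = P1Q.ofRat r then Φ hx.choose else 0

/-- `pot Φ ∞ = 0` (`Φ({∞} − {∞}) = 0`). [cite: PollackStevens2011, §2.1 (p. 7)] -/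
theorem pot_infty {V : Type*} [Zero V] (Φ : ℚ → V) : pot Φ P1Q.infty = 0 := by
  have hn : ¬ ∃ r : ℚ, P1Q.infty = P1Q.ofRat r := fun ⟨r, hr⟩ => ofRat_ne_infty r hr.symm
  unfold pot
  rw [dif_neg hn]

/-- `pot Φ r = Φ r` (the value on the basis divisor `{∞} − {r}`). [cite: PollackStevens2011, §2.1 (p. 7)] -/
theorem pot_ofRat {V : Type*} [Zero V] (Φ : ℚ → V) (r : ℚ) : pot Φ (P1Q.ofRat r) = Φ r := by
  have hx : ∃ r' : ℚ, P1Q.ofRat r = P1Q.ofRat r' := ⟨r, rfl⟩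
  have hr : hx.choose = r := (ofRat_injective hx.choose_spec).symm
  unfold pot
  rw [dif_pos hx, hr]

/-- `pot` extends `extInfty` along `toP1Q`. [folklore] -/
private theorem pot_toP1Q {V : Type*} [Zero V] (Φ : ℚ → V) (x : Option ℚ) : pot Φ (toP1Q x) = extInfty Φ x := by
  cases x with
  | none => rw [toP1Q_none, pot_infty]; rfl
  | some r => rw [toP1Q_some, pot_ofRat]; rfl

/-- `extInfty Φ (γ·x) = pot Φ (γ·toP1Q x)`: the item's `moebius`/`extInfty` bookkeeping is evaluation of
the potential at the projective image. [cite: PollackStevens2011, §2.1 (p. 7)] -/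
theorem extInfty_moebius {V : Type*} [Zero V] (Φ : ℚ → V) (γ : Matrix (Fin 2) (Fin 2) ℤ)
    (hγ : γ.det ≠ 0) (x : Option ℚ) : extInfty Φ (moebius γ x) = pot Φ (P1Q.act γ (toP1Q x)) := by
  rw [← pot_toP1Q, toP1Q_moebius γ hγ]

/-- **`slash₀` as a difference of the potential**: `(φ|γ)(r) = pot φ (γ r) − pot φ (γ ∞)`.
[cite: PollackStevens2011, §2.1 (p. 7): "(φ|γ)(D) := φ(γD)|γ"] -/
theorem slash₀_apply (φ : ℚ → ℚ_[p]) (γ : Matrix (Fin 2) (Fin 2) ℤ) (hγ : γ.det ≠ 0) (r : ℚ) :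
    slash₀ φ γ r = pot φ (P1Q.act γ (P1Q.ofRat r)) - pot φ (P1Q.act γ P1Q.infty) := by
  change extInfty φ (moebius γ (some r)) - extInfty φ (moebius γ none) = _
  rw [extInfty_moebius φ γ hγ, extInfty_moebius φ γ hγ, toP1Q_some, toP1Q_none]

/-! ## §3 `MSymb p M` is `Symb_{Γ₀(M)}(Sym⁰ ℚ_p)` -/

/-- **The value function of a two-cusp symbol**: `valFun ψ (r) = ψ(∞, r)` (the value on the divisor
`{r} − {∞}`; `Δ₀` has the `ℤ`-basis `{r} − {∞}`, `r ∈ ℚ`). [cite: PollackStevens2011, §2.1 (p. 7)] -/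
def valFun (ψ : P1Q → P1Q → (Fin 1 → ℚ_[p])) : ℚ → ℚ_[p] := fun r => ψ P1Q.infty (P1Q.ofRat r) 0

/-- Unfolding `valFun`. [cite: PollackStevens2011, §2.1 (p. 7)] -/
theorem valFun_apply (ψ : P1Q → P1Q → (Fin 1 → ℚ_[p])) (r : ℚ) :
    valFun ψ r = ψ P1Q.infty (P1Q.ofRat r) 0 := rfl

/-- `valFun` is additive (`Symb_Γ(V)` is a module, values taken pointwise). [cite: PollackStevens2011, §2.1 (p. 7)] -/
theorem valFun_add (ψ ψ' : P1Q → P1Q → (Fin 1 → ℚ_[p])) : valFun (ψ + ψ') = valFun ψ + valFun ψ' := rfl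

/-- `valFun` is homogeneous. [cite: PollackStevens2011, §2.1 (p. 7)] -/
theorem valFun_smul (c : ℚ_[p]) (ψ : P1Q → P1Q → (Fin 1 → ℚ_[p])) : valFun (c • ψ) = c • valFun ψ := rfl

/-- `valFun` of a finite sum. [cite: PollackStevens2011, §2.1 (p. 7)] -/
theorem valFun_sum {ι : Type*} (s : Finset ι) (ψ : ι → P1Q → P1Q → (Fin 1 → ℚ_[p])) :
    valFun (∑ j ∈ s, ψ j) = ∑ j ∈ s, valFun (ψ j) := by
  funext r
  simp only [valFun, Finset.sum_apply]

/-- The potential of the value function of an ADDITIVE `ψ` is `x ↦ ψ(∞, x)` (also at `x = ∞`, where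
`ψ(∞, ∞) = 0`). [cite: PollackStevens2011, §2.1 (p. 7)] -/
theorem pot_valFun {ψ : P1Q → P1Q → (Fin 1 → ℚ_[p])} (hψ : ψ ∈ modSym ℚ_[p] (Fin 1 → ℚ_[p]))
    (x : P1Q) : pot (valFun ψ) x = ψ P1Q.infty x 0 := by
  rcases P1Q.infty_or_ofRat x with rfl | ⟨r, rfl⟩
  · rw [pot_infty, modSym_self hψ]; rfl
  · rw [pot_ofRat]; rfl

/-- **The dictionary is slash-equivariant**: `(valFun ψ)|γ = valFun (ψ|γ)` for additive `ψ` and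
`det γ ≠ 0` (weight `0`: `Sym⁰` transports the cusps only, `symPowOn_zero_slash`).
[cite: PollackStevens2011, §2.1 (p. 7)] -/
theorem slash₀_valFun (S : Set (Matrix (Fin 2) (Fin 2) ℤ)) {ψ : P1Q → P1Q → (Fin 1 → ℚ_[p])}
    (hψ : ψ ∈ modSym ℚ_[p] (Fin 1 → ℚ_[p])) (γ : Matrix (Fin 2) (Fin 2) ℤ) (hγ : γ.det ≠ 0) :
    slash₀ (valFun ψ) γ = valFun ((CoeffActionOn.symPowOn S 0 ℚ_[p]).slash γ ψ) := by
  funext r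
  rw [slash₀_apply _ γ hγ, pot_valFun hψ, pot_valFun hψ, valFun_apply, symPowOn_zero_slash]
  have h := congrFun ((mem_modSym_iff (R := ℚ_[p])).mp hψ P1Q.infty (P1Q.act γ P1Q.infty)
    (P1Q.act γ (P1Q.ofRat r))) 0
  rw [Pi.add_apply] at h
  linear_combination -h

variable (p) in
/-- **From `Symb_{Γ₀(M)}(Sym⁰ ℚ_p)` to `MSymb p M`**: the value function of a `Γ₀(M)`-invariant additive
two-cusp symbol satisfies the `Γ₀(M)`-relations of `MSymb`. [cite: PollackStevens2011, §2.1 (p. 7)] -/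
def MSymb.ofSymb {S : Set (Matrix (Fin 2) (Fin 2) ℤ)} {M : ℕ} (ψ : P1Q → P1Q → (Fin 1 → ℚ_[p]))
    (hψ : ψ ∈ (CoeffActionOn.symPowOn S 0 ℚ_[p]).Symb (Gamma0 M)) : MSymb p M where
  toFun := valFun ψ
  slash₀_eq γ hγ := by
    rw [slash₀_valFun S hψ.1 _ (P1Q.det_coe_sl_ne_zero γ), hψ.2 γ hγ]

/-- The value function of `MSymb.ofSymb ψ`. [cite: PollackStevens2011, §2.1 (p. 7)] -/
@[simp] theorem MSymb.ofSymb_toFun {S : Set (Matrix (Fin 2) (Fin 2) ℤ)} {M : ℕ}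
    (ψ : P1Q → P1Q → (Fin 1 → ℚ_[p])) (hψ : ψ ∈ (CoeffActionOn.symPowOn S 0 ℚ_[p]).Symb (Gamma0 M)) :
    (MSymb.ofSymb p ψ hψ).toFun = valFun ψ := rfl

/-- **From `MSymb p M` to two-cusp symbols**: `φ.toSymb (x, y) = pot φ y − pot φ x` (`= Φ({y} − {x})`).
[cite: PollackStevens2011, §2.1 (p. 7)] -/
def MSymb.toSymb {M : ℕ} (φ : MSymb p M) : P1Q → P1Q → (Fin 1 → ℚ_[p]) :=
  fun x y _ => pot φ.toFun y - pot φ.toFun x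

/-- Unfolding `MSymb.toSymb`. [cite: PollackStevens2011, §2.1 (p. 7)] -/
@[simp] theorem MSymb.toSymb_apply {M : ℕ} (φ : MSymb p M) (x y : P1Q) (i : Fin 1) :
    φ.toSymb x y i = pot φ.toFun y - pot φ.toFun x := rfl

/-- The `Γ₀(M)`-relations of `MSymb` say: the potential transforms by the constant `pot φ (γ∞)`,
`pot φ (γx) = pot φ x + pot φ (γ∞)`. [cite: PollackStevens2011, §2.1 (p. 7)] -/
theorem MSymb.pot_act {M : ℕ} (φ : MSymb p M) {γ : SL(2, ℤ)} (hγ : γ ∈ Gamma0 M) (x : P1Q) :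
    pot φ.toFun (P1Q.act (γ : Matrix (Fin 2) (Fin 2) ℤ) x) =
      pot φ.toFun x + pot φ.toFun (P1Q.act (γ : Matrix (Fin 2) (Fin 2) ℤ) P1Q.infty) := by
  rcases P1Q.infty_or_ofRat x with rfl | ⟨r, rfl⟩
  · rw [pot_infty, zero_add]
  · have h := congrFun (φ.slash₀_eq γ hγ) r
    rw [slash₀_apply _ _ (P1Q.det_coe_sl_ne_zero γ)] at h
    rw [pot_ofRat]
    linear_combination h

/-- **`φ.toSymb ∈ Symb_{Γ₀(M)}(Sym⁰ ℚ_p)`** (additive by construction; `Γ₀(M)`-invariant by `MSymb.pot_act`).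
[cite: PollackStevens2011, §2.1 (p. 7)] -/
theorem MSymb.toSymb_mem (S : Set (Matrix (Fin 2) (Fin 2) ℤ)) {M : ℕ} (φ : MSymb p M) :
    φ.toSymb ∈ (CoeffActionOn.symPowOn S 0 ℚ_[p]).Symb (Gamma0 M) := by
  refine ⟨(mem_modSym_iff (R := ℚ_[p])).mpr fun x y z => ?_, fun γ hγ => ?_⟩
  · funext i
    simp only [Pi.add_apply, MSymb.toSymb_apply]
    ring
  · funext x y i
    rw [symPowOn_zero_slash, MSymb.toSymb_apply, MSymb.toSymb_apply, φ.pot_act hγ x, φ.pot_act hγ y]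
    ring

/-- `valFun (φ.toSymb) = φ`: the round trip on value functions. [cite: PollackStevens2011, §2.1 (p. 7)] -/
theorem MSymb.valFun_toSymb {M : ℕ} (φ : MSymb p M) : valFun φ.toSymb = φ.toFun := by
  funext r
  rw [valFun_apply, MSymb.toSymb_apply, pot_ofRat, pot_infty, sub_zero]

/-- `(MSymb.ofSymb ψ).toSymb = ψ` for `ψ ∈ Symb`: an additive two-cusp symbol is determined by its values
`ψ(∞, r)` (`Δ₀` is generated by the `{r} − {∞}`). [cite: PollackStevens2011, §2.1 (p. 7)] -/
theorem MSymb.toSymb_ofSymb {S : Set (Matrix (Fin 2) (Fin 2) ℤ)} {M : ℕ}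
    (ψ : P1Q → P1Q → (Fin 1 → ℚ_[p])) (hψ : ψ ∈ (CoeffActionOn.symPowOn S 0 ℚ_[p]).Symb (Gamma0 M)) :
    (MSymb.ofSymb p ψ hψ).toSymb = ψ := by
  funext x y i
  have hi : i = 0 := Subsingleton.elim _ _
  subst hi
  rw [MSymb.toSymb_apply, MSymb.ofSymb_toFun, pot_valFun hψ.1, pot_valFun hψ.1]
  have h := congrFun ((mem_modSym_iff (R := ℚ_[p])).mp hψ.1 P1Q.infty x y) 0
  rw [Pi.add_apply] at h
  linear_combination -h

/-- Two classical symbols with the same value function are equal (a symbol IS its values on the basis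
`{∞} − {r}`). [cite: PollackStevens2011, §2.1 (p. 7)] -/
theorem MSymb.ext' {M : ℕ} {φ φ' : MSymb p M} (h : φ.toFun = φ'.toFun) : φ = φ' := by
  cases φ with
  | mk f hf =>
    cases φ' with
    | mk f' hf' =>
      cases h
      rfl

variable (p) in
/-- **`MSymb p M ≃ Symb_{Γ₀(M)}(Sym⁰ ℚ_p)`**: the item's classical weight-two symbols (value functions on
`ℚ`) are exactly the tree's `Γ₀(M)`-invariant additive two-cusp symbols with trivial (`Sym⁰`)
coefficients. [cite: PollackStevens2011, §2.1 (p. 7)] -/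
def MSymb.equivSymb (S : Set (Matrix (Fin 2) (Fin 2) ℤ)) (M : ℕ) :
    MSymb p M ≃ ↥((CoeffActionOn.symPowOn S 0 ℚ_[p]).Symb (Gamma0 M)) where
  toFun φ := ⟨φ.toSymb, φ.toSymb_mem S⟩
  invFun ψ := MSymb.ofSymb p ψ.1 ψ.2
  left_inv φ := MSymb.ext' (MSymb.valFun_toSymb φ)
  right_inv ψ := Subtype.ext (MSymb.toSymb_ofSymb ψ.1 ψ.2)

/-- **The values of a classical symbol are bounded** (Manin: every value is a `ℤ`-combination of the
finitely many unimodular values; Mazur–Tate–Teitelbaum's bounded denominators): the tree's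
`exists_norm_apply_le` read through `MSymb.equivSymb`. [cite: MazurTateTeitelbaum1986Invent, §I.8]
[cite: Manin1972, §1.6] -/
theorem MSymb.exists_norm_le {M : ℕ} [NeZero M] (φ : MSymb p M) : ∃ C : ℝ, 0 ≤ C ∧ ∀ r, ‖φ.toFun r‖ ≤ C := by
  obtain ⟨C, hC0, hC⟩ := exists_norm_apply_le (S := (Set.univ : Set (Matrix (Fin 2) (Fin 2) ℤ)))
    (φ.toSymb_mem Set.univ)
  refine ⟨C, hC0, fun r => ?_⟩
  have h := hC P1Q.infty (P1Q.ofRat r)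
  rwa [MSymb.toSymb_apply, pot_ofRat, pot_infty, sub_zero] at h

/-! ## §4 Hecke equivariance of the dictionary -/

/-- Sums over `ℤ/q` by the lift `j ↦ j.val ∈ [0, q)` are sums over `range q`. [folklore] -/
private theorem sum_zmod_val_eq_sum_range {α : Type*} [AddCommMonoid α] {q : ℕ} [NeZero q] (G : ℕ → α) :
    ∑ j : ZMod q, G j.val = ∑ u ∈ Finset.range q, G u := by
  obtain ⟨n, hn⟩ : ∃ n, q = n + 1 := ⟨q - 1, (Nat.succ_pred_eq_of_pos (Nat.pos_of_ne_zero (NeZero.ne q))).symm⟩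
  subst hn
  exact Fin.sum_univ_eq_sum_range G (n + 1)

/-- `(1 u; 0 q)` of the item is the tree's Hecke representative `β_u`. [folklore] -/
private theorem heckeRep_some_eq_heckeMat {q : ℕ} (j : ZMod q) :
    heckeRep q (some j) = heckeMat (j.val : ℤ) (q : ℤ) := rfl

/-- `det (1 u; 0 q) = q`. [folklore] -/
private theorem det_heckeMat (u q : ℤ) : (heckeMat u q).det = q := by
  simp [heckeMat, Matrix.det_fin_two_of]

/-- **`U_p` is transported**: `(valFun ψ)|U_p = valFun (ψ|U_p)` at level `Np`, for additive `ψ`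
(`U_p = ∑_{u mod p} ·|(1 u; 0 p)` on both sides: the item's `Up₀` and the tree's `hecke (N p) p`).
[cite: PollackStevens2011, §2.1 (p. 8): "φ|U_q = ∑_{a=0}^{q−1} φ|(1 a; 0 q)"] -/
theorem Up₀_valFun (S : Set (Matrix (Fin 2) (Fin 2) ℤ)) (N : ℕ) {ψ : P1Q → P1Q → (Fin 1 → ℚ_[p])}
    (hψ : ψ ∈ modSym ℚ_[p] (Fin 1 → ℚ_[p])) :
    Up₀ (valFun ψ) = valFun ((CoeffActionOn.symPowOn S 0 ℚ_[p]).hecke (N * p) p ψ) := by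
  have hp : p.Prime := Fact.out
  haveI : NeZero p := ⟨hp.ne_zero⟩
  funext r
  rw [CoeffActionOn.hecke_level_mul_eq_sum, valFun_sum, Finset.sum_apply]
  change ∑ u ∈ Finset.range p, slash₀ (valFun ψ) (heckeMat u p) r = _
  rw [← sum_zmod_val_eq_sum_range (fun u : ℕ => slash₀ (valFun ψ) (heckeMat u p) r)]
  refine Finset.sum_congr rfl fun j _ => ?_
  rw [heckeRep_some_eq_heckeMat, slash₀_valFun S hψ _ (by rw [det_heckeMat]; exact_mod_cast hp.ne_zero)]

/-- **`T_ℓ` is transported** (`ℓ ∤ M`): `(valFun ψ)|T_ℓ = valFun (ψ|T_ℓ)` (`T_ℓ = ·|(ℓ 0; 0 1) + ∑_a ·|(1 a;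
0 ℓ)`: the item's `Tl₀` and the tree's `hecke M ℓ = hecke (M ℓ) ℓ + ·|δ_ℓ`).
[cite: PollackStevens2011, §2.1 (p. 8): "φ|T_ℓ = φ|(ℓ 0; 0 1) + ∑_{a=0}^{ℓ−1} φ|(1 a; 0 ℓ)"] -/
theorem Tl₀_valFun (S : Set (Matrix (Fin 2) (Fin 2) ℤ)) {M ℓ : ℕ} [NeZero ℓ] (hℓM : ¬ ℓ ∣ M)
    {ψ : P1Q → P1Q → (Fin 1 → ℚ_[p])} (hψ : ψ ∈ modSym ℚ_[p] (Fin 1 → ℚ_[p])) :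
    Tl₀ ℓ (valFun ψ) = valFun ((CoeffActionOn.symPowOn S 0 ℚ_[p]).hecke M ℓ ψ) := by
  have hℓ0 : ℓ ≠ 0 := NeZero.ne ℓ
  funext r
  rw [CoeffActionOn.hecke_eq_hecke_level_mul_add _ hℓM, CoeffActionOn.hecke_level_mul_eq_sum, valFun_add,
    valFun_sum, Pi.add_apply, Finset.sum_apply, add_comm]
  change slash₀ (valFun ψ) !![(ℓ : ℤ), 0; 0, 1] r + ∑ a ∈ Finset.range ℓ, slash₀ (valFun ψ) (heckeMat a ℓ) r = _
  rw [← sum_zmod_val_eq_sum_range (fun a : ℕ => slash₀ (valFun ψ) (heckeMat a ℓ) r)]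
  congr 1
  · rw [slash₀_valFun S hψ _ (by simp [Matrix.det_fin_two_of]; exact hℓ0)]
    rfl
  · refine Finset.sum_congr rfl fun j _ => ?_
    rw [heckeRep_some_eq_heckeMat, slash₀_valFun S hψ _ (by rw [det_heckeMat]; exact_mod_cast hℓ0)]

/-- **The involution is transported**: `(valFun ψ)|ι = valFun (ψ|ι)`, `ι = (−1 0; 0 1) = iotaMat`.
[cite: PollackStevens2011, §2.1 (p. 8), the involution ι] -/
theorem invol₀_valFun (S : Set (Matrix (Fin 2) (Fin 2) ℤ)) {ψ : P1Q → P1Q → (Fin 1 → ℚ_[p])}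
    (hψ : ψ ∈ modSym ℚ_[p] (Fin 1 → ℚ_[p])) :
    invol₀ (valFun ψ) = valFun ((CoeffActionOn.symPowOn S 0 ℚ_[p]).slash iotaMat ψ) := by
  rw [invol₀, slash₀_valFun S hψ _ (by simp [Matrix.det_fin_two_of])]
  rfl

/-- **Eigen-equations transport**: if `ψ ∈ Symb_{Γ₀(Np)}(Sym⁰ ℚ_p)` has `ψ|U_p = α ψ` in the tree's sense,
then the classical symbol `MSymb.ofSymb ψ` has `φ|U_p = α φ` in the item's sense — the hypothesis shape of
`stevensControl_slope_lt_one`. [cite: PollackStevens2011, §2.1 (p. 8)] -/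
theorem Up₀_ofSymb_of_hecke_eq_smul {S : Set (Matrix (Fin 2) (Fin 2) ℤ)} {N : ℕ}
    {ψ : P1Q → P1Q → (Fin 1 → ℚ_[p])} (hψ : ψ ∈ (CoeffActionOn.symPowOn S 0 ℚ_[p]).Symb (Gamma0 (N * p)))
    {α : ℚ_[p]} (hα : (CoeffActionOn.symPowOn S 0 ℚ_[p]).hecke (N * p) p ψ = α • ψ) :
    Up₀ (MSymb.ofSymb p ψ hψ).toFun = α • (MSymb.ofSymb p ψ hψ).toFun := by
  rw [MSymb.ofSymb_toFun, Up₀_valFun S N hψ.1, hα, valFun_smul]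

/-! ## §5 `φ_f ∈ Symb_{Γ₀(N)}(ℚ_p)` and `φ_β ∈ Symb_{Γ₀(Np)}(ℚ_p)` -/

section Classical

variable {N : ℕ} [NeZero N] (f : CuspForm (Gamma0 N) 2)

omit [NeZero N] in
/-- The potential of `φ_f` is the tree's rational plus potential read in `ℚ_p`. [cite: MazurTateTeitelbaum1986Invent, §I.8] -/
theorem pot_phiClassical (x : P1Q) : pot (phiClassical (p := p) f) x = ((ratPot f x : ℚ) : ℚ_[p]) := by
  rcases P1Q.infty_or_ofRat x with rfl | ⟨r, rfl⟩
  · rw [pot_infty, ratPot_infty, Rat.cast_zero]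
  · rw [pot_ofRat, ratPot_ofRat]; rfl

omit [NeZero N] in
/-- The value function of the tree's `padSymb f` is `φ_f = phiClassical f`. [cite: MazurTateTeitelbaum1986Invent, §I.8] -/
theorem valFun_padSymb : valFun (padSymb f (p := p)) = phiClassical f := by
  funext r
  rw [valFun_apply, padSymb_apply, ratPot_ofRat, ratPot_infty, sub_zero]
  rfl

omit [NeZero N] in
/-- The value function of the tree's `p`-stabilised symbol `padStabSymb f β` is `φ_β = phiBeta f β`
(`δ·r = p r`, `δ·∞ = ∞`). [cite: MazurTateTeitelbaum1986Invent, §I.10] -/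
theorem valFun_padStabSymb (β : ℚ_[p]ˣ) : valFun (padStabSymb f β) = phiBeta f (β : ℚ_[p]) := by
  funext r
  rw [valFun_apply, padStabSymb_apply, act_deltaMat_ofRat, act_deltaMat_infty, ratPot_ofRat, ratPot_ofRat,
    ratPot_infty, sub_zero, sub_zero, Units.val_inv_eq_inv_val]
  rfl

/-- **`φ_f ∈ Symb_{Γ₀(N)}(ℚ_p)`**: the classical plus symbol `r ↦ [r]⁺_f` of a normalised newform with
rational coefficients, as a member of `MSymb p N` (from the tree's `padSymb_mem_Symb`; `Ω⁺_f > 0` by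
`IsNewform0.plusPeriod_pos_holds`). [cite: PollackStevens2011, §6.3 (p. 30), φ_f^± ∈ Symb_Γ₀] [cite: MazurTateTeitelbaum1986Invent, §I.8] -/
def phiClassicalMSymb (hf : IsNewform0 f) (hQ : coeffField f = ⊥) : MSymb p N :=
  MSymb.ofSymb p (padSymb f) (padSymb_mem_Symb f hf hQ (IsNewform0.plusPeriod_pos_holds hf hQ).ne')

/-- The value function of `phiClassicalMSymb f` is `phiClassical f = (r ↦ [r]⁺_f)`. [cite: MazurTateTeitelbaum1986Invent, §I.8] -/
@[simp] theorem phiClassicalMSymb_toFun (hf : IsNewform0 f) (hQ : coeffField f = ⊥) :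
    (phiClassicalMSymb (p := p) f hf hQ).toFun = phiClassical f :=
  valFun_padSymb f

/-- **`φ_β ∈ Symb_{Γ₀(Np)}(ℚ_p)`**: for `p ∤ N` and ANY non-zero root `β ∈ ℚ_p` of `X² − a_p X + p` (unit
root or critical-slope root alike) the `p`-stabilised plus symbol `φ_β = φ_f − β⁻¹ φ_f|(p 0; 0 1)` is a
classical modular symbol of level `Γ₀(Np)`, as a member of `MSymb p (N·p)` (from the tree's
`padStabSymb_spec`, which also gives `φ_β|U_p = β φ_β`; cf. `Up₀_phiBeta`).
[cite: PollackStevens2011, §8 (p. 39) "φ_β" and Def. 6.4 (p. 31)] [cite: MazurTateTeitelbaum1986Invent, §I.10] -/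
def phiBetaMSymb (hf : IsNewform0 f) (hQ : coeffField f = ⊥) (hpN : ¬ p ∣ N) {ap : ℚ}
    (hap : (ap : ℂ) = cuspCoeff f p) {β : ℚ_[p]} (hβ0 : β ≠ 0)
    (hβ : β ^ 2 - (ap : ℚ_[p]) * β + p = 0) : MSymb p (N * p) :=
  MSymb.ofSymb p (padStabSymb f (Units.mk0 β hβ0))
    (padStabSymb_spec f hf hQ (IsNewform0.plusPeriod_pos_holds hf hQ).ne' hpN hap (Units.mk0 β hβ0)
      (by rw [Units.val_mk0]; exact hβ)).1

/-- The value function of `phiBetaMSymb f β` is `phiBeta f β = (r ↦ [r]⁺ − β⁻¹[pr]⁺)`. [cite: MazurTateTeitelbaum1986Invent, §I.10] -/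
@[simp] theorem phiBetaMSymb_toFun (hf : IsNewform0 f) (hQ : coeffField f = ⊥) (hpN : ¬ p ∣ N) {ap : ℚ}
    (hap : (ap : ℂ) = cuspCoeff f p) {β : ℚ_[p]} (hβ0 : β ≠ 0) (hβ : β ^ 2 - (ap : ℚ_[p]) * β + p = 0) :
    (phiBetaMSymb (p := p) f hf hQ hpN hap hβ0 hβ).toFun = phiBeta f β := by
  rw [phiBetaMSymb, MSymb.ofSymb_toFun, valFun_padStabSymb, Units.val_mk0]

/-- **`φ_β|U_p = β φ_β` transported from the tree's `padStabSymb_spec`** (a second proof of `Up₀_phiBeta`,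
through the dictionary). [cite: MazurTateTeitelbaum1986Invent, §I.10] -/
theorem Up₀_phiBetaMSymb_toFun (hf : IsNewform0 f) (hQ : coeffField f = ⊥) (hpN : ¬ p ∣ N) {ap : ℚ}
    (hap : (ap : ℂ) = cuspCoeff f p) {β : ℚ_[p]} (hβ0 : β ≠ 0) (hβ : β ^ 2 - (ap : ℚ_[p]) * β + p = 0) :
    Up₀ (phiBetaMSymb (p := p) f hf hQ hpN hap hβ0 hβ).toFun =
      β • (phiBetaMSymb (p := p) f hf hQ hpN hap hβ0 hβ).toFun := by
  have h := (padStabSymb_spec f hf hQ (IsNewform0.plusPeriod_pos_holds hf hQ).ne' hpN hap (Units.mk0 β hβ0)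
    (by rw [Units.val_mk0]; exact hβ)).2
  rw [Units.val_mk0] at h
  exact Up₀_ofSymb_of_hecke_eq_smul _ h

/-- **`φ_W ∈ Symb_{Γ₀(N)}(ℚ_p)` for the newform of an elliptic curve** (`IsNewformOf W f`: normalised newform,
`a_n(f) = a_n(W) ∈ ℤ`, so `coeffField f = ℚ`). [cite: PollackStevens2011, §6.3 (p. 30)] -/
def phiClassicalMSymbOf {W : WeierstrassCurve ℚ} (hf : IsNewformOf W f) : MSymb p N :=
  phiClassicalMSymb f hf.1 hf.coeffField_eq_bot

/-- Its value function is `phiClassical f`. [cite: PollackStevens2011, §6.3 (p. 30)] -/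
@[simp] theorem phiClassicalMSymbOf_toFun {W : WeierstrassCurve ℚ} (hf : IsNewformOf W f) :
    (phiClassicalMSymbOf (p := p) f hf).toFun = phiClassical f :=
  phiClassicalMSymb_toFun f _ _

/-- **`φ_β ∈ Symb_{Γ₀(Np)}(ℚ_p)` for the newform of an elliptic curve**, `p ∤ N`, `β ≠ 0` a root of
`X² − a_p(W) X + p` — the setting of `IsEigenLift W f β` / `pollackStevens_criticalSlope_eigenLift`.
[cite: PollackStevens2011, Def. 6.4 (p. 31) and §8 (p. 39)] -/
def phiBetaMSymbOf {W : WeierstrassCurve ℚ} (hf : IsNewformOf W f) (hpN : ¬ p ∣ N) {β : ℚ_[p]}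
    (hβ0 : β ≠ 0) (hβ : β ^ 2 - (W.LFunction p : ℚ_[p]) * β + p = 0) : MSymb p (N * p) :=
  phiBetaMSymb f hf.1 hf.coeffField_eq_bot hpN (ap := (W.LFunction p : ℚ))
    (by rw [hf.2 p, Rat.cast_intCast]) hβ0 (by rw [Rat.cast_intCast]; exact hβ)

/-- Its value function is `phiBeta f β`. [cite: PollackStevens2011, Def. 6.4 (p. 31) and §8 (p. 39)] -/
@[simp] theorem phiBetaMSymbOf_toFun {W : WeierstrassCurve ℚ} (hf : IsNewformOf W f) (hpN : ¬ p ∣ N)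
    {β : ℚ_[p]} (hβ0 : β ≠ 0) (hβ : β ^ 2 - (W.LFunction p : ℚ_[p]) * β + p = 0) :
    (phiBetaMSymbOf (p := p) f hf hpN hβ0 hβ).toFun = phiBeta f β :=
  phiBetaMSymb_toFun f _ _ _ _ _ _

/-- **The specialisation of an overconvergent eigen-lift is the classical symbol `φ_β`**: if
`ρ₀^*(Φ) = φ_β` (e.g. `IsEigenLift W f β Φ`) then `specialize Φ = phiBetaMSymbOf f …` as members of
`MSymb p (N·p)`. [cite: PollackStevens2011, Def. 6.4 (p. 31)] -/
theorem specialize_eq_phiBetaMSymbOf {W : WeierstrassCurve ℚ} (hf : IsNewformOf W f) (hpN : ¬ p ∣ N)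
    {β : ℚ_[p]} (hβ0 : β ≠ 0) (hβ : β ^ 2 - (W.LFunction p : ℚ_[p]) * β + p = 0)
    {Φ : OMSymb p (N * p)} (hΦ : specializeFun Φ.toFun = phiBeta f β) :
    specialize Φ = phiBetaMSymbOf (p := p) f hf hpN hβ0 hβ :=
  MSymb.ext' (by rw [specialize_toFun, hΦ, phiBetaMSymbOf_toFun])

end Classical

end OMSWeightTwo

end Literature.NumberTheory.EllipticCurves

end
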